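import Summits.CriticalPhenomena.SAWScalingLimit.Theorems.SAWTotalPositivityBoundaryTP2SquareGadget
import Literature.Probability.RandomPlanarGeometry.SupercriticalSAWProp3Holds
import Literature.Probability.RandomPlanarGeometry.SAWBridgeRadius
import HarnessLib

/-!
# Crux `BoundaryTP2` (stmt-CriticalPhenomena-7115), line `Sketch`: the core fails at every
supercritical fugacity — `x_c` is the exact edge of graph-TP₂

`GraphTP2At x` (TP₂ of the fugacity-`x` self-avoiding path kernel for every interlaced, disjointly
realisable quadruple of every finite subgraph of `ℤ²`; the crux `BoundaryTP2` is `GraphTP2At x_c`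
transferred to domains) is **false for every `x` with `x_c < x < 1`**:

  `not_graphTP2At_of_criticalFugacity_lt : SAW.criticalFugacity < x → x < 1 → ¬ GraphTP2At x`.

So the conjectured inequality sits exactly at the edge of positivity: if the crux holds, then
`x_c = max {x ∈ (0,1) : GraphTP2At x}` (with `graphTP2At_criticalFugacity_of_subcritical`, the set of
admissible fugacities is closed from below), a variational characterisation of the connective
constant `μ = 1/x_c` by a total-positivity property; and no proof of the crux can avoid an input that
is false above `x_c` (the refuters' finite thresholds `x₀(L) ↓ x_c⁺` made into a theorem).

Proof. By the square gadget (`pathKernel_le_one_of_graphTP2At`), `GraphTP2At x` with `0 < x < 1`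
forces `Z_B(w,w') ≤ 1` for the graph `B_m` of all lattice edges of the square `[0,2m+1]²` and its
bottom cardinal edge `w w' = [(m,0),(m+1,0)]` (the outer unit square hangs below the box). Every
self-avoiding polygon of the square through that edge is, minus the edge, a self-avoiding path
`w → w'` of `B_m` using exactly its other edges (`exists_path_of_isCycle_of_mem_edges`), injectively;
hence the Duminil-Copin–Kozma–Yadin partition function `Z_m(x)` of polygons through the four cardinal
edges (`SAW.Zbox`) satisfies `Z_m(x) ≤ x · Z_{B_m}(w,w') ≤ x < 1` for all `m`. But for `x > x_c`,
`limsup_m Z_m(x) = ∞` — Proposition 3 of DKY 2014, PROVED in the tree (`SAW.DKY2014_prop3_holds`,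
from the Hammersley–Welsh bridge bound and the Hardy–Ramanujan unfolding estimate). Everything here
is proved. [folklore]
-/

noncomputable section

namespace Summit.CriticalPhenomena.SAWScalingLimit.Theorems.BoundaryTP2

open Literature.Probability.LatticeModels Literature.Probability.RandomPlanarGeometry
open scoped ENNReal

variable {V : Type*}

/-! ## A cycle through an edge is that edge plus a self-avoiding path between its endpoints -/

/-- **Opening a cycle at an edge.** If a cycle `c` passes through the edge `a b`, there is a
self-avoiding path `a → b` not using that edge whose edges together with `a b` are exactly the
edges of `c`. [folklore] -/
theorem exists_path_of_isCycle_of_mem_edges [DecidableEq V] {G : SimpleGraph V} {u a b : V}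
    (c : G.Walk u u) (hc : c.IsCycle) (he : s(a, b) ∈ c.edges) :
    ∃ p : G.Path a b, s(a, b) ∉ p.1.edges ∧ insert s(a, b) p.1.edges.toFinset = c.edges.toFinset := by
  -- rotate the cycle to `a`
  have ha : a ∈ c.support := c.fst_mem_support_of_mem_edges he
  have hdc : (c.rotate a ha).IsCycle := hc.rotate ha
  have hrot := SimpleGraph.Walk.rotate_edges c a ha
  have hde : (c.rotate a ha).edges.toFinset = c.edges.toFinset := List.toFinset_eq_of_perm _ _ hrot.perm
  have hde' : s(a, b) ∈ (c.rotate a ha).edges := hrot.mem_iff.2 he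
  rw [← hde]
  generalize c.rotate a ha = d at hdc hde' ⊢
  -- `d = a v ⋯ a`
  obtain ⟨v, h, q, rfl⟩ := SimpleGraph.Walk.not_nil_iff.1 hdc.not_nil
  rw [SimpleGraph.Walk.cons_isCycle_iff] at hdc
  rw [SimpleGraph.Walk.edges_cons, List.mem_cons] at hde'
  by_cases hvb : v = b
  · subst hvb
    refine ⟨⟨q.reverse, hdc.1.reverse⟩, ?_, ?_⟩
    · rw [SimpleGraph.Walk.edges_reverse, List.mem_reverse]; exact hdc.2
    · simp only [SimpleGraph.Walk.edges_reverse, List.toFinset_reverse, SimpleGraph.Walk.edges_cons,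
        List.toFinset_cons]
  · have hne : s(a, b) ≠ s(a, v) := by
      intro h'
      rcases Sym2.eq_iff.1 h' with ⟨-, h'⟩ | ⟨h', -⟩
      · exact hvb h'.symm
      · exact h.ne h'
    have hmem : s(a, b) ∈ q.edges := hde'.resolve_left hne
    -- the last edge of the path `q : v → a` is the only one at `a`, so it is `b a`
    obtain ⟨z, h', q', hq'⟩ := SimpleGraph.Walk.exists_eq_cons_of_ne h.ne q.reverse
    have hpath' : (SimpleGraph.Walk.cons h' q').IsPath := hq' ▸ hdc.1.reverse
    rw [SimpleGraph.Walk.cons_isPath_iff] at hpath'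
    have hmem' : s(a, b) ∈ (SimpleGraph.Walk.cons h' q').edges := by
      rw [← hq', SimpleGraph.Walk.edges_reverse, List.mem_reverse]; exact hmem
    rw [SimpleGraph.Walk.edges_cons, List.mem_cons] at hmem'
    rcases hmem' with heq | hmem'
    · have hzb : z = b := by
        rcases Sym2.eq_iff.1 heq with ⟨-, h1⟩ | ⟨h1, -⟩
        · exact h1.symm
        · exact absurd h1 h'.ne
      subst hzb
      have hnot : a ∉ q'.reverse.support := by
        rw [SimpleGraph.Walk.support_reverse, List.mem_reverse]; exact hpath'.2
      refine ⟨⟨SimpleGraph.Walk.cons h q'.reverse,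
        (SimpleGraph.Walk.cons_isPath_iff h q'.reverse).2 ⟨hpath'.1.reverse, hnot⟩⟩, ?_, ?_⟩
      · rw [SimpleGraph.Walk.edges_cons, List.mem_cons, not_or]
        refine ⟨hne, fun hm => hpath'.2 ?_⟩
        rw [SimpleGraph.Walk.edges_reverse, List.mem_reverse] at hm
        exact q'.fst_mem_support_of_mem_edges hm
      · have hq : q = (SimpleGraph.Walk.cons h' q').reverse := by
          rw [← hq', SimpleGraph.Walk.reverse_reverse]
        rw [hq]
        simp only [SimpleGraph.Walk.edges_cons, SimpleGraph.Walk.edges_reverse, List.toFinset_reverse,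
          List.toFinset_cons]
        exact Finset.insert_comm _ _ _
    · exact absurd (q'.fst_mem_support_of_mem_edges hmem') hpath'.2


/-! ## The box graph of `[0, 2m+1]²` and the bottom cardinal edge -/

section Box

/-- Points of `ℤ²` used below: `w = (m,0)`, `w' = (m+1,0)` (the bottom cardinal edge of `[0,2m+1]²`)
and `u = (m,-1)`, `u' = (m+1,-1)` (the outer unit square below it). Adjacencies in `ℤ²`. [folklore] -/
private theorem zd_adj_of_eq_add_single {a b : Site 2} (i : Fin 2) (h : b = a + Pi.single i 1) :
    (zdGraph 2).Adj a b :=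
  (zdGraph_adj_iff a b).2 ⟨i, Or.inl h⟩

/-- `(m,0) ∼ (m+1,0)` in `ℤ²`. [folklore] -/
private theorem adj_w_w' (m : ℕ) : (zdGraph 2).Adj (![(m : ℤ), 0]) (![(m : ℤ) + 1, 0]) :=
  zd_adj_of_eq_add_single 0 (by ext i; fin_cases i <;> simp)

/-- `(m,-1) ∼ (m+1,-1)` in `ℤ²`. [folklore] -/
private theorem adj_u_u' (m : ℕ) : (zdGraph 2).Adj (![(m : ℤ), -1]) (![(m : ℤ) + 1, -1]) :=
  zd_adj_of_eq_add_single 0 (by ext i; fin_cases i <;> simp)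

/-- `(m,0) ∼ (m,-1)` in `ℤ²`. [folklore] -/
private theorem adj_w_u (m : ℕ) : (zdGraph 2).Adj (![(m : ℤ), 0]) (![(m : ℤ), -1]) :=
  (zd_adj_of_eq_add_single 1 (by ext i; fin_cases i <;> simp)).symm

/-- `(m+1,-1) ∼ (m+1,0)` in `ℤ²`. [folklore] -/
private theorem adj_u'_w' (m : ℕ) : (zdGraph 2).Adj (![(m : ℤ) + 1, -1]) (![(m : ℤ) + 1, 0]) :=
  zd_adj_of_eq_add_single 1 (by ext i; fin_cases i <;> simp)

end Box

/-- **The core fails above `x_c`.** For every fugacity `x` with `x_c < x < 1`, `GraphTP2At x` is false.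
See the module docstring for the proof (square gadget + polygons of a box + DKY Proposition 3).
[cite: DuminilCopinKozmaYadin2014, Proposition 3] -/
theorem not_graphTP2At_of_criticalFugacity_lt {x : ℝ} (hxc : SAW.criticalFugacity < x) (hx1 : x < 1) :
    ¬ GraphTP2At x := by
  classical
  intro h
  have hx0 : 0 < x := lt_trans SAW.criticalFugacity_pos hxc
  -- for every `m`, `Z_m(x) ≤ x`
  have hbox : ∀ m : ℕ, SAW.Zbox m x ≤ x := by
    intro m
    -- the box graph
    set Λ := SAW.squareBox m with hΛ
    set S : Set (Sym2 (Site 2)) := ↑(edgesIn (zdGraph 2) Λ) with hS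
    set B := SimpleGraph.fromEdgeSet S with hB
    have hBadj : ∀ a b, B.Adj a b ↔ s(a, b) ∈ edgesIn (zdGraph 2) Λ ∧ a ≠ b := fun a b => by
      rw [hB, SimpleGraph.fromEdgeSet_adj, hS, Finset.mem_coe]
    have hBle : B ≤ zdGraph 2 := by
      intro a b hab
      rw [hBadj] at hab
      exact (SimpleGraph.mem_edgeSet (zdGraph 2)).1 ((mem_edgesIn_iff).1 hab.1).1
    have hsupp : ∀ a, a ∈ B.support → a ∈ Λ := by
      intro a ha
      obtain ⟨b, hab⟩ := (B.mem_support).1 ha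
      rw [hBadj] at hab
      exact ((mem_edgesIn_iff).1 hab.1).2 a (Sym2.mem_mk_left _ _)
    have hBfin : B.support.Finite := (Λ.finite_toSet).subset fun a ha => hsupp a ha
    -- the bottom cardinal edge and the outer square below it
    set w : Site 2 := ![(m : ℤ), 0] with hw
    set w' : Site 2 := ![(m : ℤ) + 1, 0] with hw'
    set u : Site 2 := ![(m : ℤ), -1] with hu
    set u' : Site 2 := ![(m : ℤ) + 1, -1] with hu'
    have hwΛ : w ∈ Λ := by
      rw [hΛ, SAW.mem_squareBox_iff]; intro i; fin_cases i <;> simp [hw] <;> omega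
    have hw'Λ : w' ∈ Λ := by
      rw [hΛ, SAW.mem_squareBox_iff]; intro i; fin_cases i <;> simp [hw'] <;> omega
    have huΛ : u ∉ Λ := by
      rw [hΛ, SAW.mem_squareBox_iff]; intro hh; have := (hh 1).1; simp [hu] at this
    have hu'Λ : u' ∉ Λ := by
      rw [hΛ, SAW.mem_squareBox_iff]; intro hh; have := (hh 1).1; simp [hu'] at this
    have he₀ : s(w, w') ∈ edgesIn (zdGraph 2) Λ := by
      rw [mem_edgesIn_iff]
      refine ⟨(SimpleGraph.mem_edgeSet _).2 (adj_w_w' m), fun a ha => ?_⟩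
      rcases Sym2.mem_iff.1 ha with rfl | rfl
      exacts [hwΛ, hw'Λ]
    have hww' : B.Adj w w' := (hBadj w w').2 ⟨he₀, (adj_w_w' m).ne⟩
    have huB : u ∉ B.support := fun hh => huΛ (hsupp u hh)
    have hu'B : u' ∉ B.support := fun hh => hu'Λ (hsupp u' hh)
    -- the gadget bound
    have hZ : pathKernel B x w w' ≤ 1 :=
      pathKernel_le_one_of_graphTP2At hx0 hx1 h B hBle hBfin hww' (adj_w_u m) (adj_u_u' m)
        (adj_u'_w' m) huB hu'B
    -- polygons of the box through `w w'` ↦ paths `w → w'` of `B`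
    have hpoly : ∀ E ∈ SAW.facePolygons m, ∃ p : B.Path w w',
        p.1.length + 1 = E.card ∧ insert s(w, w') p.1.edges.toFinset = E := by
      intro E hE
      obtain ⟨hEsub, ⟨v, c, hc, hcE⟩, hcard⟩ := SAW.mem_facePolygons_iff.1 hE
      have he₀E : s(w, w') ∈ E := hcard (by simp [SAW.cardinalEdges, hw, hw'])
      have he₀c : s(w, w') ∈ c.edges := by rw [← List.mem_toFinset, hcE]; exact he₀E
      obtain ⟨p, hpe, hpE⟩ := exists_path_of_isCycle_of_mem_edges c hc he₀c
      rw [hcE] at hpE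
      -- transfer the path to `B`
      have hpB : ∀ e ∈ p.1.edges, e ∈ B.edgeSet := by
        intro e he
        have heE : e ∈ E := by rw [← hpE]; exact Finset.mem_insert_of_mem (List.mem_toFinset.2 he)
        rw [hB, SimpleGraph.edgeSet_fromEdgeSet, hS]
        exact ⟨Finset.mem_coe.2 (hEsub heE), (zdGraph 2).not_isDiag_of_mem_edgeSet (p.1.edges_subset_edgeSet he)⟩
      refine ⟨⟨p.1.transfer B hpB, p.2.transfer hpB⟩, ?_, ?_⟩
      · rw [SimpleGraph.Walk.length_transfer, ← hpE, ← SimpleGraph.Walk.length_edges]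
        rw [Finset.card_insert_of_notMem (fun hh => hpe (List.mem_toFinset.1 hh)),
          List.toFinset_card_of_nodup p.2.isTrail.edges_nodup]
      · rw [SimpleGraph.Walk.edges_transfer]; exact hpE
    haveI : Nonempty (B.Path w w') := ⟨SimpleGraph.Path.singleton hww'⟩
    choose! Φ hΦlen hΦE using hpoly
    -- the injection bound `Σ_E x^{|E|-1} ≤ Z_B(w,w') ≤ 1`
    set P := SAW.facePolygons m with hP
    have hinj : Function.Injective fun E : P => Φ E.1 := by
      intro E₁ E₂ heq
      apply Subtype.ext
      rw [← hΦE E₁.1 E₁.2, ← hΦE E₂.1 E₂.2]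
      exact congrArg (fun γ : B.Path w w' => insert s(w, w') γ.1.edges.toFinset) heq
    have hsum : (∑ E ∈ P, ENNReal.ofReal (x ^ (E.card - 1))) ≤ pathKernel B x w w' := by
      calc (∑ E ∈ P, ENNReal.ofReal (x ^ (E.card - 1)))
          = ∑ E ∈ P, ENNReal.ofReal (x ^ (Φ E).1.length) := by
            refine Finset.sum_congr rfl fun E hE => ?_
            rw [← hΦlen E hE, Nat.add_sub_cancel]
        _ = ∑ E : P, ENNReal.ofReal (x ^ (Φ E.1).1.length) := (Finset.sum_coe_sort P _).symm
        _ = ∑' E : P, ENNReal.ofReal (x ^ (Φ E.1).1.length) := (tsum_fintype _).symm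
        _ ≤ ∑' γ : B.Path w w', ENNReal.ofReal (x ^ γ.1.length) :=
            ENNReal.tsum_comp_le_tsum_of_injective hinj fun γ : B.Path w w' => ENNReal.ofReal (x ^ γ.1.length)
        _ = pathKernel B x w w' := rfl
    have hT : (∑ E ∈ P, x ^ (E.card - 1)) ≤ 1 := by
      have h1 : (∑ E ∈ P, ENNReal.ofReal (x ^ (E.card - 1))) ≤ 1 := hsum.trans hZ
      rw [← ENNReal.ofReal_sum_of_nonneg fun E _ => pow_nonneg hx0.le _] at h1
      exact ENNReal.ofReal_le_one.1 h1
    -- `Z_m(x) = x · Σ_E x^{|E|-1}`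
    have hcard : ∀ E ∈ P, 1 ≤ E.card := fun E hE => by
      rw [← hΦlen E hE]; exact Nat.le_add_left 1 _
    calc SAW.Zbox m x = ∑ E ∈ P, x * x ^ (E.card - 1) := by
          rw [SAW.Zbox]
          refine Finset.sum_congr rfl fun E hE => ?_
          rw [← pow_succ', Nat.sub_add_cancel (hcard E hE)]
      _ = x * ∑ E ∈ P, x ^ (E.card - 1) := by rw [Finset.mul_sum]
      _ ≤ x * 1 := mul_le_mul_of_nonneg_left hT hx0.le
      _ = x := mul_one x
  -- DKY Proposition 3: `Z_m(x) ≥ 1` for infinitely many `m`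
  obtain ⟨m, hm⟩ := (SAW.DKY2014_prop3_holds x hxc 1).exists
  exact absurd ((hm.trans (hbox m)).trans_lt hx1) (lt_irrefl 1)

/-- **`x_c` is the edge of graph-TP₂.** If the core holds at some `x ∈ (0,1)` then `x ≤ x_c`; in
particular the crux `BoundaryTP2` (the core at `x_c`, `boundaryTP2_of_graphTP2At`) asserts the inequality
at the largest fugacity at which it can possibly hold. [cite: DuminilCopinKozmaYadin2014, Proposition 3] -/
theorem le_criticalFugacity_of_graphTP2At {x : ℝ} (hx1 : x < 1) (h : GraphTP2At x) :
    x ≤ SAW.criticalFugacity :=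
  le_of_not_gt fun hxc => not_graphTP2At_of_criticalFugacity_lt hxc hx1 h

end Summit.CriticalPhenomena.SAWScalingLimit.Theorems.BoundaryTP2
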